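import Summits.BirchSwinnertonDyer.BirchSwinnertonDyer.Theorems.KimAtThreeDeepLowerOffKatoStratumAssembly
import Summits.BirchSwinnertonDyer.BirchSwinnertonDyer.Theorems.KimAtThreeDeepLowerOffStratumResidue
import Summits.BirchSwinnertonDyer.BirchSwinnertonDyer.Theorems.KimAtThreeDeepLowerOffStratumAdditiveDefectPortTwoExp
import Literature.NumberTheory.EllipticCurves.StabilisedLevelLoweringCongruence
import HarnessLib

/-!
# Route `KimAtThreeKolyvagin` (rung W2), crux `DeepLowerAtThreeOffKatoStratum` (item 19679) and its parent
# `DeepLowerAtThree` (item 19075): the OWNER'S ASSEMBLY after PROGRAMME PART 1b — both decls BY NAME modulo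
# the finest residual the tree affords (2026-08-26, end of the acc2 / acc3 hands)

Cell `bsd-addord`, seat `bsd-addord-w2-c2` (gen 5, OWNER of `stmt-BirchSwinnertonDyer-19679`, parent
`stmt-BirchSwinnertonDyer-19075`). Sequel to `KimAtThreeDeepLowerOffKatoStratumAssembly` (gen 4, p461846 /
p463450 / p464521): the BC3 skeleton's composition `DeepLowerAtThreeOffKatoStratum_of` (case split on
`Addv W₀ 3`) is run on the two hands' FINAL stub-shaped theorems —

* non-additive rows: acc2 g2's ★★ `KimAtThreeDeepLowerOffStratumResidue.stub_nonAdditive_of_cornerLowerHalves_…`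
  road — Miller's LOWER half `MissingLowerBoundAt W 3` on every non-additive tower row of analytic rank `0`
  from named facts (Yan–Zhu 2026 Thm. 4.15, Wuthrich 2014 L20, Skinner 2016 Thm. C, modularity ×2, GZK,
  Ribet 1990 / Diamond 1995 — on SEMISTABLE rows (ram) is a theorem) and the two displayed CORNER families
  (L_ss) good-supersingular `3`, (L_m) NON-semistable multiplicative `3` without (ram); plus Tamagawa
  divisibility of the deep Kurihara numbers, fed — as in gen 4 — from the stabilised level-lowering congruence,
  now carried under its Literature NAME `IsStabilisedLevelLoweringCongruence W₀ 3 m D₀.f q` (bsd-litref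
  p464204; plan g17 ANSWER/LL_1 (1)) at a depth `m ≥ v₃(∏ c_ℓ)`;
* additive-defect rows: acc3 g2's `KimAtThreeDeepLowerOffStratumAdditiveDefectPortTwoExp.stubAdditiveDefect_of_portTwoExp`
  — the Euler-system road: S24-DEEP (1)(2) + GZK + Poitou–Tate + the two-exponent port PORT₂
  (`KimAtThreeKolyvaginDefs.KatoKuriharaPortThreeAtWith₂TwoExp`, acc6) shared on the defect rows
  (`3 ∣ c₃ ∨ E(ℚ₃)[3] ≠ 0 ∨ 3 ∣ c_{D₀}`); NO main-conjecture input, NO Tamagawa divisibility there.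

* §1 `deepLowerAtThreeOffKatoStratum_of_facts_of_residuals_end` — crux 19679 BY NAME from ELEVEN named
  inputs (`hYZ hW20 hSk hmod hGZK hMaz hBCDT hDia` published; `hS24d hS24d₂` = S24-DEEP ports, FLAG
  `S24-DEEP-PORT@3`; `hPT` Poitou–Tate) and FOUR displayed residual binders: (L_ss), (L_m), (LL) «on every
  non-additive optimal tower row with `3 ∣ ∏ c_ℓ`: `IsStabilisedLevelLoweringCongruence W₀ 3 m D₀.f q` for
  some `m ≥ v₃(∏ c_ℓ)`, `q ∣ 3N_E`», (P₂) PORT₂-shared on the additive-defect rows.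
* §2 `deepLowerAtThree_of_katoStratumSharedParts_of_residuals_end` — the PARENT crux 19075 BY NAME: the §L
  glue (item 19680, CLOSED; `KimAtThreeDeepLowerSplitGlue.deepLowerAtThree_of_parts`) on the alias
  `KatoStratumSharedParts` (item 19678 = Sakamoto 2024 Thm. 4.4 ×2 ∧ GZK ∧ PT ∧ Carayol ∧ PORT″ crux 19560)
  and §1. So the residual of 19075 in the tree after PART 1b reads EXACTLY: {19560 (C1 fine Kato package,
  C3 anomalous bad places), S24-DEEP (1)(2), (P₂), (L_ss), (L_m), (LL at depth v₃(∏ c_ℓ))} + named print.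
* §3 `deepLowerAtThreeOffKatoStratum_of_facts_of_residuals_end_bigIm` — §1 with Yan–Zhu 2026 Thm. 4.15 in
  its PRINTED (Im) form (`…_of_bigIm`, litref p454928; plan l.812 hygiene).

HONEST FRAMING. Theorems only (no definition, no named fact asserted, no `sorry`); every theorem here is
CONDITIONAL — it concludes the route decl BY NAME but UNDER HYPOTHESES and does NOT close item 19679 or
19075 (landed `--supports … --as helper`); (L_ss) / (L_m) are summit-corner lower halves (X6/X7/X8 at `3`;
X11a at `3` off square-free conductors), (LL) at depth `1` is «Ribet + mod-`3` multiplicity one + canonical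
periods» in print but untyped as a symbol statement (acc2's `…LevelLoweringFromPrint` feeds it row-wise
from `wiles1995_multiplicityOne` + `ribet1984_iharaLemma` + cell b2b-bsdres' two typed nodes), at depth
`≥ 2` only level lowering mod `3^m` is printed; PORT₂ / S24-DEEP are flagged ports. BSD is not proved by
any of this; nothing is booked; no mark moves.

References: [YanZhu2024MainConjNonCM] Thm. 4.15; [Wuthrich2014] Lemma 20; [Skinner2016PacificMC] Thm. C;
[Ribet1990] Thm. 1.1; [Diamond1995RefinedSerre] Thm. 1.1; [Mazur1978] Cor. 4.1; [GreenbergVatsal2000] §3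
(18)–(19); [Sakamoto2024] Thm. 4.4; [MazurRubin2004] Thm. 5.2.12; [Kim2022StructureSelmer] Thm. 1.9 (6),
Thm. 3.13, Conj. 1.10; [Kim2025RefinedTNC] Thm. 1.1, §8.1.2; [Miller2011LMS] Def. 1.1.
-/

set_option autoImplicit false
-- the Theorems namespace of a single-conjunct summit repeats the summit name by design (D-0017)
set_option linter.dupNamespace false

noncomputable section

open scoped MatrixGroups ModularForm Classical NumberField

open Literature.NumberTheory.DiophantineGeometry.Dioph (ratModP)
open CongruenceSubgroup WeierstrassCurve IsDedekindDomain Literature.NumberTheory.EllipticCurves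
  Literature.NumberTheory.EllipticCurves.ModularForms
  Literature.NumberTheory.EllipticCurves.Rank1Residual
  Literature.NumberTheory.EllipticCurves.Rank1Residual.Typed
  Literature.NumberTheory.EllipticCurves.Skinner2016
  Literature.NumberTheory.Automorphic
  Literature.NumberTheory.GaloisCohomology
  Summit.BirchSwinnertonDyer.Rank1Residual.GaloisImage
  Summit.BirchSwinnertonDyer.BirchSwinnertonDyer.Theorems.Rank1ResidualX1Defs

namespace Summit.BirchSwinnertonDyer.BirchSwinnertonDyer.Theorems.KimAtThreeDeepLowerOffKatoStratumAssemblyEnd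

open Summit.BirchSwinnertonDyer.Rank1Residual
open Summit.BirchSwinnertonDyer.Rank1Residual.Additive
open Summit.BirchSwinnertonDyer.BirchSwinnertonDyer.Theses.KimAtThreeKolyvagin
open Summit.BirchSwinnertonDyer.BirchSwinnertonDyer.Theorems.KimAtThreeKolyvaginUnitLevelOneRungs
open Summit.BirchSwinnertonDyer.BirchSwinnertonDyer.Theorems.KimAtThreeKolyvaginDefs
open Summit.BirchSwinnertonDyer.BirchSwinnertonDyer.Theorems.KimAtThreeDeepLowerNonAdditiveRows
open Summit.BirchSwinnertonDyer.BirchSwinnertonDyer.Theorems.KimAtThreeDeepLowerSmallDefect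
open Summit.BirchSwinnertonDyer.BirchSwinnertonDyer.Theorems.KimAtThreeShallowEqDeepOffStratumNonAdditiveRows
open Summit.BirchSwinnertonDyer.BirchSwinnertonDyer.Theorems.KimAtThreeDeepLowerOffStratumSockets
open Summit.BirchSwinnertonDyer.BirchSwinnertonDyer.Theorems.KimAtThreeDeepLowerOffStratumNonAdditiveRows
open Summit.BirchSwinnertonDyer.BirchSwinnertonDyer.Theorems.KimAtThreeDeepLowerTamagawaLevelLowering
open Summit.BirchSwinnertonDyer.BirchSwinnertonDyer.Theorems.KimAtThreeDeepLowerOffStratumResidue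
open Summit.BirchSwinnertonDyer.BirchSwinnertonDyer.Theorems.KimAtThreeDeepLowerOffStratumAdditiveDefectPortTwoExp

/-! ### §1 Crux 19679 BY NAME — the residual after PART 1b -/

/-- **Crux 19679 `DeepLowerAtThreeOffKatoStratum` BY NAME, modulo named print, two flagged ports and FOUR
displayed residual binders** — the skeleton's composition (case split on `Addv W₀ 3`) run on acc2 g2's
corner-lower-halves road (non-additive rows) and acc3 g2's PORT₂ road (additive-defect rows). Named inputs:
`hYZ` Yan–Zhu 2026 Thm. 4.15 (PUB*, flag `YZ26@3`), `hW20`, `hSk` Skinner 2016 Thm. C, `hmod`/`hBCDT`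
modularity, `hGZK`, `hMaz` Mazur 1978 Cor. 4.1, `hDia` Ribet 1990 / Diamond 1995, `hS24d`/`hS24d₂` the
S24-DEEP ports (FLAG `S24-DEEP-PORT@3`), `hPT` Poitou–Tate. RESIDUAL displayed: (L_ss) Miller's lower half
on the good-SUPERSINGULAR-`3` tower rows of analytic rank `0`; (L_m) the same on the NON-semistable
multiplicative-`3` tower rows without (ram); (LL) on every non-additive lattice-optimal tower row of
conductor level with `3 ∣ ∏ c_ℓ`, the stabilised level-lowering congruence under its Literature NAME at
some depth `m ≥ v₃(∏ c_ℓ)` and some `q ∣ 3N_E`; (P₂) the two-exponent port PORT₂ shared on the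
additive-defect rows (acc3's `hPort₂` VERBATIM; FLAG `K22-Thm3.13-PORT@3`). CONDITIONAL: does not close
the item. [cite: YanZhu2024MainConjNonCM, Thm. 4.15 (§4.6)] [cite: Skinner2016PacificMC, Thm. C (§1)]
[cite: Ribet1990, Thm. 1.1] [cite: Mazur1978, Cor. 4.1] [cite: GreenbergVatsal2000, §3 display (18)–(19)]
[cite: Sakamoto2024, Thm. 4.4 (p. 926)] [cite: MazurRubin2004, Thm. 5.2.12] [cite: Kim2022StructureSelmer, Thm. 3.13, Conj. 1.10 (PDF p. 8)] -/
theorem deepLowerAtThreeOffKatoStratum_of_facts_of_residuals_end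
    (hYZ : YanZhu2026.thm415_padicValRat_bsd_rank_le_one)
    (hW20 : Wuthrich2014.lemma20_surjective_threeAdic_of_semistable)
    (hSk : Skinner2016.thmC_padicValRat_bsd_rank_zero)
    (hmod : hasEntireLFunction_rat) (hGZK : rank_eq_analyticRank_of_analyticRank_le_one)
    (hMaz : mazur_not_dvd_maninConstant_of_odd)
    (hBCDT : exists_isNewformOf) (hDia : diamond1995_refinedSerre)
    (hS24d : S24Deep.kolyvaginSystems_freeRankOne_zmod_three_pow_deep)
    (hS24d₂ : S24Deep.kolyvaginSystems_idealOfBasis_eq_fittingIdeal_zmod_three_pow_deep)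
    (hPT : poitouTate_selmerStructure_duality ℚ)
    (hLss : ∀ (W : WeierstrassCurve ℚ) [W.IsElliptic] [W.IsGloballyMinimal],
      (∀ n : ℕ, W.HasSurjectiveModNGaloisRep (3 ^ n : ℕ)) → W.analyticRank = 0 →
      W.HasGoodReductionAtPrime 3 → (3 : ℤ) ∣ W.frobeniusTrace 3 → MissingLowerBoundAt W 3)
    (hLm : ∀ (W : WeierstrassCurve ℚ) [W.IsElliptic] [W.IsGloballyMinimal],
      (∀ n : ℕ, W.HasSurjectiveModNGaloisRep (3 ^ n : ℕ)) → W.analyticRank = 0 →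
      W.HasMultiplicativeReductionAtPrime 3 → ¬ Semistable W →
      ¬ (haveI : Fact (Nat.Prime 3) := ⟨Nat.prime_three⟩; Ram W 3) → MissingLowerBoundAt W 3)
    (hLL : ∀ (W₀ : WeierstrassCurve ℚ) [W₀.IsElliptic] [W₀.IsGloballyMinimal],
      (∀ n : ℕ, W₀.HasSurjectiveModNGaloisRep (3 ^ n : ℕ)) →
      ∀ {N : ℕ} [NeZero N], N = W₀.conductorNorm ℤ → ∀ (D₀ : ModularParametrizationData W₀ N),
        (∀ z ∈ D₀.L.lattice, ∃ w ∈ periodLattice D₀.f, z = D₀.c * w) →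
        kuriharaVanishingOrder W₀ 3 D₀.f = 0 →
        ¬ (haveI : Fact (Nat.Prime 3) := ⟨Nat.prime_three⟩; Addv W₀ 3) → 3 ∣ W₀.tamagawaProduct →
        ∃ m : ℕ, padicValNat 3 W₀.tamagawaProduct ≤ m ∧ ∃ q : ℕ, q ∣ W₀.conductorNorm ℤ * 3 ∧
          IsStabilisedLevelLoweringCongruence W₀ 3 m D₀.f q)
    (hPort₂ : ∀ (W : WeierstrassCurve ℚ) [W.IsElliptic] [W.IsGloballyMinimal],
      (∀ m : ℕ, W.HasSurjectiveModNGaloisRep (3 ^ m : ℕ)) →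
      (haveI : Fact (Nat.Prime 3) := ⟨Nat.prime_three⟩; Addv W 3) →
      ∀ t : ℕ, Nat.card {Q : (W.baseChange ℚ_[3]).toAffine.Point // (3 : ℕ) • Q = 0} = 3 ^ t →
      ∀ (v₃ : HeightOneSpectrum (𝓞 ℚ)), ((3 : ℕ) : 𝓞 ℚ) ∈ v₃.asIdeal →
      ∀ (ηg : (q : HeightOneSpectrum (𝓞 ℚ)) → (ZMod (Ideal.absNorm q.asIdeal))ˣ),
        (∀ q, Subgroup.zpowers (ηg q) = ⊤) →
      ∀ {N : ℕ} [NeZero N] (P : ModularParametrizationData W N), N = W.conductorNorm ℤ →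
        (∀ z ∈ P.L.lattice, ∃ w ∈ periodLattice P.f, z = P.c * w) →
        (3 ∣ (W.baseChange ℚ_[3]).localTamagawaNumber ℤ_[3] ∨
          Nat.card {Q : (W.baseChange ℚ_[3]).toAffine.Point // (3 : ℕ) • Q = 0} ≠ 1 ∨
          (3 : ℤ) ∣ P.maninConstant) →
        ∃ e : ℕ, KatoKuriharaPortThreeAtWith₂TwoExp W t e v₃ ηg P) :
    Summit.BirchSwinnertonDyer.BirchSwinnertonDyer.Theses.KimAtThreeKolyvagin.DeepLowerAtThreeOffKatoStratum := by
  intro W₀ _ _ htow hfin N _ hN D₀ hopt hdeg hint hord hoff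
  haveI : Fact (Nat.Prime 3) := ⟨Nat.prime_three⟩
  by_cases hA : Addv W₀ 3
  · -- additive-defect row: acc3's PORT₂ road (the defect disjunction is `hoff` read under `hA`)
    refine stubAdditiveDefect_of_portTwoExp hS24d hS24d₂ hGZK hPT hPort₂ W₀ htow hfin hN D₀ hopt hdeg hint
      hord hA ?_
    by_contra hcon
    push Not at hcon
    exact hoff ⟨hA, hcon.1, hcon.2.1, hcon.2.2⟩
  · -- non-additive row: lower half (named print + corner families) + TamDiv-deep from (LL) at depth ≥ v₃(∏c)
    have hf : IsNewformOf W₀ D₀.f := D₀.isNewformOf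
    have hr0 : W₀.analyticRank = 0 :=
      analyticRank_eq_zero_of_kuriharaVanishingOrder_eq_zero W₀ D₀.f hf hord
    have hirr : W₀.HasIrreducibleModPGaloisRep 3 :=
      hasIrreducibleModPGaloisRep_of_hasSurjectiveModNGaloisRep W₀ 3 (by simpa using htow 1)
    have hper := periodTransfer_three_of_optimal_of_not_addv W₀ hMaz hN D₀ hopt hA
    have hlow : MissingLowerBoundAt W₀ 3 :=
      missingLowerBoundAt_three_of_not_addv_of_cornerLowerHalves hYZ hW20 hSk hmod hGZK hBCDT hDia hLss hLm
        W₀ htow hr0 hA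
    have htam : ((padicValNat 3 W₀.tamagawaProduct : ℕ) : ℕ∞) ≤ kuriharaPartialDeepInfty W₀ 3 D₀.f := by
      by_cases h3 : 3 ∣ W₀.tamagawaProduct
      · obtain ⟨m, hv, q, hq, hLLq⟩ := hLL W₀ htow hN D₀ hopt hord hA h3
        obtain ⟨u, φ, hperφ, hφH, hC⟩ := hLLq
        exact (tamagawa_le_kuriharaPartialInfty_of_stabilisedCongruence W₀ 3 m D₀.f hint hv q hq u φ hperφ
          hφH hC).2
      · rw [padicValNat.eq_zero_of_not_dvd h3, Nat.cast_zero]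
        exact zero_le
    exact deepLower_conclusion_of_missingLowerBoundAt_of_tamagawa_le_deepInfty W₀ 3 D₀.f hGZK (by norm_num)
      hirr hf hord hper hlow htam

/-! ### §2 The PARENT crux 19075 BY NAME — its complete residual after PART 1b -/

/-- **The PARENT crux 19075 `DeepLowerAtThree` BY NAME, modulo its complete displayed residual after PART 1b**
— the §L glue (item 19680, CLOSED; `KimAtThreeDeepLowerSplitGlue.deepLowerAtThree_of_parts`, p441486) on the
five-part alias `KatoStratumSharedParts` (item 19678 = Sakamoto 2024 Thm. 4.4 ×2 ∧ GZK ∧ Poitou–Tate ∧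
Carayol ∧ the shared PORT″ crux 19560) and on §1. Hence the residual of 19075 in the tree is EXACTLY:
{19560 (PORT″: C1 fine Kato package, C3 anomalous bad places), the S24-DEEP ports, (P₂) PORT₂ on the
additive-defect rows, (L_ss), (L_m), (LL) at depth `v₃(∏ c_ℓ)` on the non-additive Tamagawa rows} plus
named print (`hYZ hW20 hSk hmod hMaz hBCDT hDia`). CONDITIONAL: does not close any item; BSD is not proved
by any of this. [cite: Kim2025RefinedTNC, Thm. 1.1] [cite: Sakamoto2024, Thm. 4.4 (p. 926)]
[cite: Kim2022StructureSelmer, Thm. 3.13, Conj. 1.10 (PDF p. 8)] [cite: Mazur1978, Cor. 4.1]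
[cite: GreenbergVatsal2000, §3 display (18)–(19)] [cite: YanZhu2024MainConjNonCM, Thm. 4.15 (§4.6)] -/
theorem deepLowerAtThree_of_katoStratumSharedParts_of_residuals_end
    (hK : KatoStratumSharedParts)
    (hYZ : YanZhu2026.thm415_padicValRat_bsd_rank_le_one)
    (hW20 : Wuthrich2014.lemma20_surjective_threeAdic_of_semistable)
    (hSk : Skinner2016.thmC_padicValRat_bsd_rank_zero)
    (hmod : hasEntireLFunction_rat) (hMaz : mazur_not_dvd_maninConstant_of_odd)
    (hBCDT : exists_isNewformOf) (hDia : diamond1995_refinedSerre)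
    (hS24d : S24Deep.kolyvaginSystems_freeRankOne_zmod_three_pow_deep)
    (hS24d₂ : S24Deep.kolyvaginSystems_idealOfBasis_eq_fittingIdeal_zmod_three_pow_deep)
    (hLss : ∀ (W : WeierstrassCurve ℚ) [W.IsElliptic] [W.IsGloballyMinimal],
      (∀ n : ℕ, W.HasSurjectiveModNGaloisRep (3 ^ n : ℕ)) → W.analyticRank = 0 →
      W.HasGoodReductionAtPrime 3 → (3 : ℤ) ∣ W.frobeniusTrace 3 → MissingLowerBoundAt W 3)
    (hLm : ∀ (W : WeierstrassCurve ℚ) [W.IsElliptic] [W.IsGloballyMinimal],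
      (∀ n : ℕ, W.HasSurjectiveModNGaloisRep (3 ^ n : ℕ)) → W.analyticRank = 0 →
      W.HasMultiplicativeReductionAtPrime 3 → ¬ Semistable W →
      ¬ (haveI : Fact (Nat.Prime 3) := ⟨Nat.prime_three⟩; Ram W 3) → MissingLowerBoundAt W 3)
    (hLL : ∀ (W₀ : WeierstrassCurve ℚ) [W₀.IsElliptic] [W₀.IsGloballyMinimal],
      (∀ n : ℕ, W₀.HasSurjectiveModNGaloisRep (3 ^ n : ℕ)) →
      ∀ {N : ℕ} [NeZero N], N = W₀.conductorNorm ℤ → ∀ (D₀ : ModularParametrizationData W₀ N),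
        (∀ z ∈ D₀.L.lattice, ∃ w ∈ periodLattice D₀.f, z = D₀.c * w) →
        kuriharaVanishingOrder W₀ 3 D₀.f = 0 →
        ¬ (haveI : Fact (Nat.Prime 3) := ⟨Nat.prime_three⟩; Addv W₀ 3) → 3 ∣ W₀.tamagawaProduct →
        ∃ m : ℕ, padicValNat 3 W₀.tamagawaProduct ≤ m ∧ ∃ q : ℕ, q ∣ W₀.conductorNorm ℤ * 3 ∧
          IsStabilisedLevelLoweringCongruence W₀ 3 m D₀.f q)
    (hPort₂ : ∀ (W : WeierstrassCurve ℚ) [W.IsElliptic] [W.IsGloballyMinimal],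
      (∀ m : ℕ, W.HasSurjectiveModNGaloisRep (3 ^ m : ℕ)) →
      (haveI : Fact (Nat.Prime 3) := ⟨Nat.prime_three⟩; Addv W 3) →
      ∀ t : ℕ, Nat.card {Q : (W.baseChange ℚ_[3]).toAffine.Point // (3 : ℕ) • Q = 0} = 3 ^ t →
      ∀ (v₃ : HeightOneSpectrum (𝓞 ℚ)), ((3 : ℕ) : 𝓞 ℚ) ∈ v₃.asIdeal →
      ∀ (ηg : (q : HeightOneSpectrum (𝓞 ℚ)) → (ZMod (Ideal.absNorm q.asIdeal))ˣ),
        (∀ q, Subgroup.zpowers (ηg q) = ⊤) →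
      ∀ {N : ℕ} [NeZero N] (P : ModularParametrizationData W N), N = W.conductorNorm ℤ →
        (∀ z ∈ P.L.lattice, ∃ w ∈ periodLattice P.f, z = P.c * w) →
        (3 ∣ (W.baseChange ℚ_[3]).localTamagawaNumber ℤ_[3] ∨
          Nat.card {Q : (W.baseChange ℚ_[3]).toAffine.Point // (3 : ℕ) • Q = 0} ≠ 1 ∨
          (3 : ℤ) ∣ P.maninConstant) →
        ∃ e : ℕ, KatoKuriharaPortThreeAtWith₂TwoExp W t e v₃ ηg P) :
    Summit.BirchSwinnertonDyer.BirchSwinnertonDyer.Theses.KimAtThreeKolyvagin.DeepLowerAtThree := by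
  obtain ⟨hSak, hGZK, hPT, hlev, hPort⟩ := hK
  exact KimAtThreeDeepLowerSplitGlue.deepLowerAtThree_of_parts hSak hGZK hPT hlev hPort
    (deepLowerAtThreeOffKatoStratum_of_facts_of_residuals_end hYZ hW20 hSk hmod hGZK hMaz hBCDT hDia hS24d
      hS24d₂ hPT hLss hLm hLL hPort₂)

/-! ### §3 §1 with Yan–Zhu 2026 Thm. 4.15 in its PRINTED (Im) form -/

/-- **§1 with Yan–Zhu's theorem in its PRINTED (Im) form** (`hYZ'`: Thm. 4.15 under (Im), litref's
`thm415_padicValRat_bsd_rank_le_one_of_bigIm`; the tower-surjective special case is DERIVED by the kernel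
theorem `yanZhu_thm415_of_thm415_of_bigIm`). CONDITIONAL: does not close the item.
[cite: YanZhu2024MainConjNonCM, Thm. 4.15 (§4.6) and §4.3 (the (Im) hypothesis)] [cite: Skinner2016PacificMC, Thm. C (§1)]
[cite: Mazur1978, Cor. 4.1] [cite: GreenbergVatsal2000, §3 display (18)–(19)] [cite: Kim2022StructureSelmer, Thm. 3.13] -/
theorem deepLowerAtThreeOffKatoStratum_of_facts_of_residuals_end_bigIm
    (hYZ' : YanZhu2026.thm415_padicValRat_bsd_rank_le_one_of_bigIm)
    (hW20 : Wuthrich2014.lemma20_surjective_threeAdic_of_semistable)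
    (hSk : Skinner2016.thmC_padicValRat_bsd_rank_zero)
    (hmod : hasEntireLFunction_rat) (hGZK : rank_eq_analyticRank_of_analyticRank_le_one)
    (hMaz : mazur_not_dvd_maninConstant_of_odd)
    (hBCDT : exists_isNewformOf) (hDia : diamond1995_refinedSerre)
    (hS24d : S24Deep.kolyvaginSystems_freeRankOne_zmod_three_pow_deep)
    (hS24d₂ : S24Deep.kolyvaginSystems_idealOfBasis_eq_fittingIdeal_zmod_three_pow_deep)
    (hPT : poitouTate_selmerStructure_duality ℚ)
    (hLss : ∀ (W : WeierstrassCurve ℚ) [W.IsElliptic] [W.IsGloballyMinimal],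
      (∀ n : ℕ, W.HasSurjectiveModNGaloisRep (3 ^ n : ℕ)) → W.analyticRank = 0 →
      W.HasGoodReductionAtPrime 3 → (3 : ℤ) ∣ W.frobeniusTrace 3 → MissingLowerBoundAt W 3)
    (hLm : ∀ (W : WeierstrassCurve ℚ) [W.IsElliptic] [W.IsGloballyMinimal],
      (∀ n : ℕ, W.HasSurjectiveModNGaloisRep (3 ^ n : ℕ)) → W.analyticRank = 0 →
      W.HasMultiplicativeReductionAtPrime 3 → ¬ Semistable W →
      ¬ (haveI : Fact (Nat.Prime 3) := ⟨Nat.prime_three⟩; Ram W 3) → MissingLowerBoundAt W 3)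
    (hLL : ∀ (W₀ : WeierstrassCurve ℚ) [W₀.IsElliptic] [W₀.IsGloballyMinimal],
      (∀ n : ℕ, W₀.HasSurjectiveModNGaloisRep (3 ^ n : ℕ)) →
      ∀ {N : ℕ} [NeZero N], N = W₀.conductorNorm ℤ → ∀ (D₀ : ModularParametrizationData W₀ N),
        (∀ z ∈ D₀.L.lattice, ∃ w ∈ periodLattice D₀.f, z = D₀.c * w) →
        kuriharaVanishingOrder W₀ 3 D₀.f = 0 →
        ¬ (haveI : Fact (Nat.Prime 3) := ⟨Nat.prime_three⟩; Addv W₀ 3) → 3 ∣ W₀.tamagawaProduct →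
        ∃ m : ℕ, padicValNat 3 W₀.tamagawaProduct ≤ m ∧ ∃ q : ℕ, q ∣ W₀.conductorNorm ℤ * 3 ∧
          IsStabilisedLevelLoweringCongruence W₀ 3 m D₀.f q)
    (hPort₂ : ∀ (W : WeierstrassCurve ℚ) [W.IsElliptic] [W.IsGloballyMinimal],
      (∀ m : ℕ, W.HasSurjectiveModNGaloisRep (3 ^ m : ℕ)) →
      (haveI : Fact (Nat.Prime 3) := ⟨Nat.prime_three⟩; Addv W 3) →
      ∀ t : ℕ, Nat.card {Q : (W.baseChange ℚ_[3]).toAffine.Point // (3 : ℕ) • Q = 0} = 3 ^ t →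
      ∀ (v₃ : HeightOneSpectrum (𝓞 ℚ)), ((3 : ℕ) : 𝓞 ℚ) ∈ v₃.asIdeal →
      ∀ (ηg : (q : HeightOneSpectrum (𝓞 ℚ)) → (ZMod (Ideal.absNorm q.asIdeal))ˣ),
        (∀ q, Subgroup.zpowers (ηg q) = ⊤) →
      ∀ {N : ℕ} [NeZero N] (P : ModularParametrizationData W N), N = W.conductorNorm ℤ →
        (∀ z ∈ P.L.lattice, ∃ w ∈ periodLattice P.f, z = P.c * w) →
        (3 ∣ (W.baseChange ℚ_[3]).localTamagawaNumber ℤ_[3] ∨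
          Nat.card {Q : (W.baseChange ℚ_[3]).toAffine.Point // (3 : ℕ) • Q = 0} ≠ 1 ∨
          (3 : ℤ) ∣ P.maninConstant) →
        ∃ e : ℕ, KatoKuriharaPortThreeAtWith₂TwoExp W t e v₃ ηg P) :
    Summit.BirchSwinnertonDyer.BirchSwinnertonDyer.Theses.KimAtThreeKolyvagin.DeepLowerAtThreeOffKatoStratum :=
  deepLowerAtThreeOffKatoStratum_of_facts_of_residuals_end (yanZhu_thm415_of_thm415_of_bigIm hYZ') hW20 hSk
    hmod hGZK hMaz hBCDT hDia hS24d hS24d₂ hPT hLss hLm hLL hPort₂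

end Summit.BirchSwinnertonDyer.BirchSwinnertonDyer.Theorems.KimAtThreeDeepLowerOffKatoStratumAssemblyEnd

end
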